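import Summits.ValiantsHypothesis.ValiantsHypothesis.Theorems.BarrierLeverNaturalProofsSeparateVNPBorder
import Summits.ValiantsHypothesis.ValiantsHypothesis.Theorems.BarrierLeverNaturalProofsSeparateVNPStatus
import Literature.Computability.AlgebraicComplexity.OrbitClosureProofs
import Literature.Computability.AlgebraicComplexity.GCT

/-!
# Route BarrierLever — item `NaturalProofsSeparateVNP` (stmt-ValiantsHypothesis-18972) implies
# `BorderDcPerSuperpolynomial`; hence `KRSTForVP ∨ BorderDcPerSuperpolynomial` unconditionally
# (cell valiant-natproofs, seat val-np-p4; ladder rungs V4 ↔ V3)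

Sequel to `…NaturalProofsSeparateVNPBorder` (`S ⇒ (per_n) ∉ \overline{VP}`). Here the border
CIRCUIT statement is transferred to the border DETERMINANTAL statement of the GCT column:

* `Border.complexity_linSubst_detPoly_le` — every linear substitution instance `det_m(A·x)` has
  circuit size `≤ 8(m+1)⁷ + 2m⁴` (Berkowitz, the tree's `complexity_detPoly_le`).
* `Border.approxComplexity_perPoly_le_of_hasBorderDetRepr` — **`\underline{dc}(per_k) ≤ m ⇒
  \underline{L}(per_k) ≤ (m+2)²(8(m+1)⁷ + 2m⁴)`**: if the padded permanent `X₀₀^{m-k} per_k` lies in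
  the orbit closure `\overline{GL_{m²}·det_m}` (the tree's `HasBorderDetRepr ℂ k m`), DE-PAD —
  substitute `X₀₀ ↦ 1`, the block variables `↦` those of `per_k`, everything else `↦ 1` — on the
  degree-`m` homogeneous components: this polynomial map is Zariski continuous on coefficient
  vectors (`Border.coeffVec_mem_zariskiClosure_of_homogeneousComponent`), carries the orbit (small
  circuits, homogenised at cost `(m+2)²`, BCS Lemma (21.25)) to polynomials of size
  `≤ (m+2)²(8(m+1)⁷ + 2m⁴)`, and carries the padded permanent (a form of degree `m`) to `per_k`.
* `Border.isVPBarFamily_perPoly_of_not_borderDcPerSuperpolynomial` — so a polynomial bound on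
  `\underline{dc}(per_n)` (`¬ BorderDcPerSuperpolynomial`) puts `(per_n)` in `\overline{VP}` (the
  permanent half of `\overline{VP_ws} ⊆ \overline{VP}`, BLMW 2011 §9.3 / Prop. 9.3.2).
* `Border.borderDcPerSuperpolynomial_of_naturalProofsSeparateVNP` — **item 18972 ⇒
  `BorderDcPerSuperpolynomial`** (BLMW Conj. 1.1 = Mulmuley–Sohoni in "infinitely often" form =
  `VNP ⊄ \overline{VP_ws}`): the negative horn of the cell's win–win is at least as strong as the open
  goal of geometric complexity theory, not only as `VP ≠ VNP`.
* `Border.krstForVP_or_borderDcPerSuperpolynomial` — **unconditionally, `KRSTForVP ∨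
  BorderDcPerSuperpolynomial`** (items 18972 and 18967 cannot both fail,
  `naturalProofsSeparateVNP_or_krstForVP`); read on the hardness hypothesis
  (`Border.succinctHittingSetsForVP_or_borderDc_of_permanentExpHardWith`): if the permanent is
  `2^{n^{1/c}}`-hard then EITHER `VP` has succinct hitting sets over `ℂ` (FSV Question 6, crux
  14610) OR `\underline{dc}(per_n)` is superpolynomial. Also `Border.krstForVP_or_not_isVPBarFamily_perPoly`.

WHAT THIS IS NOT: no item closes; nothing here is evidence for `VP ≠ VNP`, for the Mulmuley–Sohoni
conjecture or for FSV Question 6 — the disjunction asserts neither disjunct, and each implication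
starts from an open statement. The mathematics (equations vanish on orbit closures; KRST's
generator is `VNP`-succinct) is standard; new is the kernel link between the tree's statements
`Theses.BarrierLever.{NaturalProofsSeparateVNP, KRSTForVP}` (V4) and
`Literature…BorderDcPerSuperpolynomial` (GCT).

References: [BurgisserEtAl2011] Conj. 1.1, Def. 9.3.1, §9.3, Prop. 9.3.2; [MulmuleySohoni2001]
§4, Conj. 4.3; [ForbesShpilkaVolk2018] §1.1; [KumarRamyaSaptharishiTengse2022] Thm. MainThm, §5;
[Berkowitz1984] §2; [BurgisserClausenShokrollahi1997] Lemma (21.25); [Burgisser2024Completeness] §7.3.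
-/

-- layout Summits/ValiantsHypothesis/ValiantsHypothesis forces the duplicated namespace component
set_option linter.dupNamespace false

noncomputable section

namespace Summit.ValiantsHypothesis.ValiantsHypothesis.Theorems.BarrierLever.NaturalProofsSeparateVNP

open Literature.Barriers.ValiantsHypothesis Literature.Computability.AlgebraicComplexity MvPolynomial
open Summit.ValiantsHypothesis.ValiantsHypothesis.Theses

namespace Border

/-! ### 6. Polynomially bounded BORDER DETERMINANTAL complexity puts the permanent in
`\overline{VP}`; hence the item implies `BorderDcPerSuperpolynomial` -/

section BorderDc

/-- The endomorphism orbit of `det_m` consists of small circuits: `L(det_m(A·x)) ≤ 8(m+1)⁷ + 2m⁴`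
(Berkowitz for `det_m`, `complexity_detPoly_le`; each of the `m²` substituted linear forms costs
`≤ 2m²`). [cite: Berkowitz1984, §2] [cite: Burgisser2000, Rem. 2.7] -/
theorem complexity_linSubst_detPoly_le (m : ℕ) (A : Matrix (Fin m × Fin m) (Fin m × Fin m) ℂ) :
    complexity (linSubst (Fin m × Fin m) ℂ A (detPoly (Fin m) ℂ)) ≤
      8 * (m + 1) ^ 7 + 2 * (m * m) ^ 2 := by
  have hlin : ∀ i : Fin m × Fin m,
      complexity (∑ j, A j i • (X j : MvPolynomial (Fin m × Fin m) ℂ)) ≤ 2 * (m * m) := by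
    intro i
    calc complexity (∑ j, A j i • (X j : MvPolynomial (Fin m × Fin m) ℂ))
        ≤ ∑ j, complexity (A j i • (X j : MvPolynomial (Fin m × Fin m) ℂ)) +
            (Finset.univ : Finset (Fin m × Fin m)).card := complexity_finset_sum_le _ _
      _ ≤ ∑ _j : Fin m × Fin m, 1 + (Finset.univ : Finset (Fin m × Fin m)).card := by
          gcongr with j
          calc complexity (A j i • (X j : MvPolynomial (Fin m × Fin m) ℂ))
              ≤ complexity (X j : MvPolynomial (Fin m × Fin m) ℂ) + 1 := complexity_smul_le_holds _ _
            _ = 1 := by rw [complexity_X_holds]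
      _ = 2 * (m * m) := by
          simp only [Finset.sum_const, Finset.card_univ, Fintype.card_prod, Fintype.card_fin,
            smul_eq_mul, mul_one]
          ring
  show complexity (aeval (fun i => ∑ j, A j i • X j) (detPoly (Fin m) ℂ)) ≤ _
  calc complexity (aeval (fun i => ∑ j, A j i • X j) (detPoly (Fin m) ℂ))
      ≤ complexity (detPoly (Fin m) ℂ) +
          ∑ i, complexity (∑ j, A j i • (X j : MvPolynomial (Fin m × Fin m) ℂ)) :=
        complexity_aeval_le _ _
    _ ≤ 8 * (m + 1) ^ 7 + ∑ _i : Fin m × Fin m, 2 * (m * m) :=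
        Nat.add_le_add (complexity_detPoly_le ℂ m) (Finset.sum_le_sum fun i _ => hlin i)
    _ = 8 * (m + 1) ^ 7 + 2 * (m * m) ^ 2 := by
        simp only [Finset.sum_const, Finset.card_univ, Fintype.card_prod, Fintype.card_fin,
          smul_eq_mul]
        ring

/-- **`\underline{dc}(per_k) ≤ m` ⇒ `\underline{L}(per_k) ≤ (m+2)²(8(m+1)⁷ + 2m⁴)`** (the easy
inclusion `\overline{VP_ws} ⊆ \overline{VP}` of BLMW 2011 §9.3, at the permanent, quantitatively).
If the padded permanent `X₀₀^{m-k} per_k` lies in the orbit closure `\overline{GL_{m²}·det_m}`, then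
DE-PADDING — the substitution `X₀₀ ↦ 1`, block variables `↦` the variables of `per_k`, all other
variables `↦ 1` — applied to the degree-`m` components (`coeffVec_mem_zariskiClosure_of_
homogeneousComponent`; the padded permanent IS its degree-`m` component) carries the orbit, whose
members are small circuits (`complexity_linSubst_detPoly_le`, homogenised), onto approximants of
`per_k`. [cite: BurgisserEtAl2011, §9.3] [cite: MulmuleySohoni2001, §4] -/
theorem approxComplexity_perPoly_le_of_hasBorderDetRepr {k m : ℕ} [NeZero m] (hkm : k ≤ m)
    (h : HasBorderDetRepr ℂ k m) :
    approxComplexity (perPoly (Fin k) ℂ) ≤ (m + 2) ^ 2 * (8 * (m + 1) ^ 7 + 2 * (m * m) ^ 2) := by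
  classical
  have hcard : Fintype.card (BlockIdx k m) = Fintype.card (Fin k) := by
    rw [card_blockIdx hkm, Fintype.card_fin]
  let e : BlockIdx k m ≃ Fin k := Fintype.equivOfCardEq hcard
  let τ' : Fin m × Fin m → MvPolynomial (Fin k × Fin k) ℂ := fun ij =>
    if hij : m - k ≤ (ij.1 : ℕ) ∧ m - k ≤ (ij.2 : ℕ) then X (e ⟨ij.1, hij.1⟩, e ⟨ij.2, hij.2⟩) else 1
  have hτ0 : ∀ ij, complexity (τ' ij) = 0 := by
    intro ij
    simp only [τ']
    split_ifs
    · exact complexity_X_holds _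
    · rw [← C_1]; exact complexity_C_holds _
  -- de-padding computes `per_k`
  have hblock : (τ' ∘ fun ij : BlockIdx k m × BlockIdx k m => ((ij.1 : Fin m), (ij.2 : Fin m))) =
      X ∘ Prod.map e e := by
    funext ij
    obtain ⟨i, j⟩ := ij
    simp only [Function.comp_apply, τ', dif_pos (show m - k ≤ ((i : Fin m) : ℕ) ∧
      m - k ≤ ((j : Fin m) : ℕ) from ⟨i.2, j.2⟩), Subtype.coe_eta]
    rfl
  have hpad : (τ' ((0 : Fin m), (0 : Fin m))) ^ (m - k) = 1 := by
    rcases Nat.eq_zero_or_pos (m - k) with h0 | hpos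
    · rw [h0, pow_zero]
    · have h00 : τ' ((0 : Fin m), (0 : Fin m)) = 1 := by
        simp only [τ']
        rw [dif_neg]
        rintro ⟨h1, -⟩
        rw [Fin.val_zero] at h1
        omega
      rw [h00, one_pow]
  have hdepad : aeval τ' (paddedPerPoly ℂ k m) = perPoly (Fin k) ℂ := by
    show aeval τ' (X (0, 0) ^ (m - k) * rename
      (fun ij : BlockIdx k m × BlockIdx k m => ((ij.1 : Fin m), (ij.2 : Fin m)))
      (perPoly (BlockIdx k m) ℂ)) = perPoly (Fin k) ℂ
    rw [map_mul, map_pow, aeval_X, hpad, one_mul, aeval_rename, hblock, ← rename_eq_aeval]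
    exact rename_perPoly_equiv e
  -- transport the orbit closure along the de-padding of degree-`m` components
  set R := 8 * (m + 1) ^ 7 + 2 * (m * m) ^ 2 with hR
  have himg := coeffVec_mem_zariskiClosure_of_homogeneousComponent (aeval τ').toLinearMap m
    (S := glOrbit (Fin m × Fin m) ℂ (detPoly (Fin m) ℂ))
    (T := {g' : MvPolynomial (Fin k × Fin k) ℂ | complexity g' ≤ (m + 2) ^ 2 * R})
    (fun g hg => ?_) h
  · rw [AlgHom.toLinearMap_apply, homogeneousComponent_eq_self (paddedPerPoly_isHomogeneous hkm),
      hdepad] at himg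
    exact Nat.sInf_le himg
  · obtain ⟨A, rfl⟩ := glOrbit_subset_endOrbit _ hg
    show complexity (aeval τ' (homogeneousComponent m
      (linSubst (Fin m × Fin m) ℂ A (detPoly (Fin m) ℂ)))) ≤ (m + 2) ^ 2 * R
    calc complexity (aeval τ' (homogeneousComponent m (linSubst (Fin m × Fin m) ℂ A
          (detPoly (Fin m) ℂ))))
        ≤ complexity (homogeneousComponent m (linSubst (Fin m × Fin m) ℂ A (detPoly (Fin m) ℂ))) +
            ∑ ij, complexity (τ' ij) := complexity_aeval_le _ _
      _ = complexity (homogeneousComponent m (linSubst (Fin m × Fin m) ℂ A (detPoly (Fin m) ℂ))) := by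
          simp [hτ0]
      _ ≤ (m + 2) ^ 2 * complexity (linSubst (Fin m × Fin m) ℂ A (detPoly (Fin m) ℂ)) :=
          complexity_homogeneousComponent_le_sq_mul _ _
      _ ≤ (m + 2) ^ 2 * R := Nat.mul_le_mul_left _ (complexity_linSubst_detPoly_le m A)

/-- **Polynomially bounded border determinantal complexity of the permanent puts `(per_n)` in
`\overline{VP}`** (`¬ BorderDcPerSuperpolynomial → IsVPBarFamily per`; the permanent half of
"`\overline{VP_ws} ⊆ \overline{VP}`", BLMW 2011 §9.3, Prop. 9.3.2).
[cite: BurgisserEtAl2011, §9.3 and Prop. 9.3.2] -/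
theorem isVPBarFamily_perPoly_of_not_borderDcPerSuperpolynomial (h : ¬ BorderDcPerSuperpolynomial) :
    IsVPBarFamily fun n => perPoly (Fin n) ℂ := by
  unfold BorderDcPerSuperpolynomial at h
  rw [not_not] at h
  obtain ⟨c, hc⟩ := h
  have hpc : IsPBounded fun n => n ^ c + c := ⟨c, fun n => le_rfl⟩
  refine IsPBounded.mono (t := fun n => (n ^ c + c + 2) ^ 2 *
    (8 * (n ^ c + c + 1) ^ 7 + 2 * ((n ^ c + c) * (n ^ c + c)) ^ 2)) ?_ fun n => ?_
  · exact IsPBounded.mul_holds (IsPBounded.pow_holds (IsPBounded.add_holds hpc (IsPBounded.const 2)) 2)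
      (IsPBounded.add_holds
        (IsPBounded.mul_holds (IsPBounded.const 8)
          (IsPBounded.pow_holds (IsPBounded.add_holds hpc (IsPBounded.const 1)) 7))
        (IsPBounded.mul_holds (IsPBounded.const 2)
          (IsPBounded.pow_holds (IsPBounded.mul_holds hpc hpc) 2)))
  · obtain ⟨m, hm, hnm, hmc, hrep⟩ := hc n
    calc approxComplexity (perPoly (Fin n) ℂ)
        ≤ (m + 2) ^ 2 * (8 * (m + 1) ^ 7 + 2 * (m * m) ^ 2) :=
          approxComplexity_perPoly_le_of_hasBorderDetRepr hnm hrep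
      _ ≤ (n ^ c + c + 2) ^ 2 * (8 * (n ^ c + c + 1) ^ 7 + 2 * ((n ^ c + c) * (n ^ c + c)) ^ 2) := by
          gcongr

/-- **Item 18972 ⇒ `BorderDcPerSuperpolynomial`** — the border determinantal complexity of the
permanent over `ℂ` is not polynomially bounded (the Mulmuley–Sohoni conjecture in the
"infinitely often" form of Bürgisser–Landsberg–Manivel–Weyman 2011, Conj. 1.1; equivalently
`VNP ⊄ \overline{VP_ws}`, Prop. 9.3.2): combine `not_isVPBarFamily_perPoly` with
`isVPBarFamily_perPoly_of_not_borderDcPerSuperpolynomial`. So the negative horn of the cell's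
win–win is at least as strong as the open goal of geometric complexity theory.
[cite: BurgisserEtAl2011, Conj. 1.1 and Prop. 9.3.2] [cite: MulmuleySohoni2001, Conj. 4.3] -/
theorem borderDcPerSuperpolynomial_of_naturalProofsSeparateVNP
    (hS : BarrierLever.NaturalProofsSeparateVNP) : BorderDcPerSuperpolynomial := by
  by_contra h
  exact not_isVPBarFamily_perPoly hS (isVPBarFamily_perPoly_of_not_borderDcPerSuperpolynomial h)

/-- **Unconditional disjunction across the ladder's columns: `KRSTForVP ∨ BorderDcPerSuperpolynomial`.**
Either item 18967 holds (exponential hardness of the permanent ⇒ FSV Question 6 over `ℂ`, the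
algebraic natural-proofs barrier for `VP`), or the permanent has superpolynomial border
determinantal complexity (BLMW Conj. 1.1). From `naturalProofsSeparateVNP_or_krstForVP` (items 18972
and 18967 cannot both fail) and `borderDcPerSuperpolynomial_of_naturalProofsSeparateVNP`. Both
disjuncts are open; the disjunction asserts neither. [cite: KumarRamyaSaptharishiTengse2022, §5]
[cite: BurgisserEtAl2011, Conj. 1.1] -/
theorem krstForVP_or_borderDcPerSuperpolynomial :
    BarrierLever.KRSTForVP ∨ BorderDcPerSuperpolynomial :=
  naturalProofsSeparateVNP_or_krstForVP.elim
    (fun hS => Or.inr (borderDcPerSuperpolynomial_of_naturalProofsSeparateVNP hS)) Or.inl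

/-- The same with the stronger second disjunct `(per_n) ∉ \overline{VP}`:
`KRSTForVP ∨ ¬ IsVPBarFamily per`. [cite: KumarRamyaSaptharishiTengse2022, §5]
[cite: BurgisserEtAl2011, §9.3] -/
theorem krstForVP_or_not_isVPBarFamily_perPoly :
    BarrierLever.KRSTForVP ∨ ¬ IsVPBarFamily fun n => perPoly (Fin n) ℂ :=
  naturalProofsSeparateVNP_or_krstForVP.elim (fun hS => Or.inr (not_isVPBarFamily_perPoly hS)) Or.inl

/-- **Read on the hardness hypothesis: if the permanent is `2^{n^{1/c}}`-hard (eventually), then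
EITHER `VP` has succinct hitting sets (FSV Question 6 over `ℂ`, crux 14610) OR the permanent has
superpolynomial border determinantal complexity.** (KRST 2022 prove the `VNP` analogue of the first
disjunct under the same hypothesis; for `VP` the question is printed-open, Bürgisser 2024 §7.3 —
this disjunction is what the kernel currently knows in that direction.)
[cite: KumarRamyaSaptharishiTengse2022, Thm. MainThm and §5] [cite: BurgisserEtAl2011, Conj. 1.1] -/
theorem succinctHittingSetsForVP_or_borderDc_of_permanentExpHardWith {c m₀ : ℕ}
    (hper : PermanentExpHardWith ℂ c m₀) :
    Literature.Barriers.ValiantsHypothesis.SuccinctHittingSetsForVP ℂ ∨ BorderDcPerSuperpolynomial :=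
  krstForVP_or_borderDcPerSuperpolynomial.imp_left fun hK => hK ⟨c, m₀, hper⟩

end BorderDc

end Border

end Summit.ValiantsHypothesis.ValiantsHypothesis.Theorems.BarrierLever.NaturalProofsSeparateVNP

end
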